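import Summits.QuantumFields.YangMills.Theses.CentreWallReflection
import Summits.QuantumFields.YangMills.Theorems.TwistExponentGapPeriodicToronFloorToronBox
import Literature.MathematicalPhysics.QuantumFieldTheory.WilsonEnergyConvexity
import HarnessLib

/-!
# Route `CentreWallReflection` (planner ym-idea-4 g18, LINE g18-A), item ⟨stmt-QuantumFields-23708⟩ `SubexponentialFloor` — CLOSED

`subexponentialFloor_proof : Summit.QuantumFields.YangMills.Theses.CentreWallReflection.SubexponentialFloor`:
for every compact `G` with a faithful unitary lattice representation `r`, every inline twisted partition function `Z`,
every torus side `S = L + 1 ≥ 2`, plane `q`, `s > 0` and `ε > 0`, eventually in `β`: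
`S² · e^{−sβ} ≤ ε · Z(β, S, 1, q)`.

Proof.  §1 `wilsonPartition_toron_floor` — a ROUTE-INDEPENDENT restatement (generic `[MeasurableSpace G] [BorelSpace G]`) of
the periodic toron floor of ⟨stmt-QuantumFields-24055⟩: `∫ e^{−β S_W} dHaar^E ≥ c · β^{−(3S⁴−1)·D/2}` for `β ≥ 1`, `D = dimE r.ρ`
(proof adapted verbatim from `Theorems/TwistExponentGapPeriodicToronFloor.lean`: Markov at the level `βS_W ≤ 18·#P`
(`exp_mul_measureReal_le_integral_exp`), the toron box of `…ToronBox.pow_mul_pow_le_measureReal_wilsonAction_le` with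
`t = β^{−1/4}`, small balls `Haar(B_δ) ≥ C δ^D` (`FreeEnergyLogCoefficient.exists_haar_gball_ge`)); it is stated here so that
this module imports no other route's `Theses` file (theses-cone hygiene).  §2 the periodic sector `z = 1` of the inline `Z` is
that Wilson integral, and `β^κ · e^{−sβ} → 0` (`tendsto_rpow_mul_exp_neg_mul_atTop_nhds_zero`), so eventually
`S² e^{−sβ} = S² (β^κ e^{−sβ}) β^{−κ} ≤ S² · (εc/S²) · β^{−κ} = ε · (c β^{−κ}) ≤ ε · Z`.  Simplicity of `G` is not used.
HONEST FRAMING: a routine support item; the cruxes `NegligibleWalls` ⟨23706⟩ and `WallReflection` ⟨23707⟩ of the route remain OPEN;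
no rung / summit statement is proved; the Yang–Mills mass gap is NOT proved.  THEOREMS ONLY (0 `def`, 0 `sorry`), standard axioms.
References: [cite: Luscher1983, §2]; [cite: BorgsSeiler1983]; [cite: Chatterjee2016, Lemma 9.3 and Cor. 6.3].
-/

set_option autoImplicit false

noncomputable section

open scoped Matrix.Norms.Frobenius
open MeasureTheory Filter Topology
open Literature.MathematicalPhysics.QuantumFieldTheory
open Summit.QuantumFields.YangMills.Theorems.FreeEnergyLogCoefficient (dimE exists_haar_gball_ge)
open Summit.QuantumFields.YangMills.Theorems.TwistExponentGap.ToronFloor (pow_mul_pow_le_measureReal_wilsonAction_le)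

namespace Summit.QuantumFields.YangMills.Theorems.CentreWallReflection

/-! ## §1 The periodic toron floor of the Wilson partition function (route-independent form) -/

/-- **Toron floor of the Wilson partition function** (route-independent form of ⟨stmt-QuantumFields-24055⟩): for a compact group `G`
with a faithful unitary lattice representation `r` and every torus side `n + 1`, there is `c > 0` with
`c · β^{−(3(n+1)⁴−1)·D/2} ≤ ∫ e^{−β S_W(U)} dHaar^E(U)` for all `β ≥ 1`, `D = dimE r.ρ`; explicitly `c = e^{−18·#P}·C^{3(n+1)⁴+1}` with
`C` the small-ball constant of `exists_haar_gball_ge`.  Markov at the level `βS_W ≤ 18·#P`, the toron box with `t = β^{−1/4}`, small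
balls `Haar(B_δ) ≥ Cδ^D`.  [cite: Chatterjee2016, Lemma 9.3 and Cor. 6.3] [cite: Luscher1983, §2] -/
theorem wilsonPartition_toron_floor {G : Type} [Group G] [TopologicalSpace G] [IsTopologicalGroup G] [CompactSpace G]
    [MeasurableSpace G] [BorelSpace G] (r : LatticeRep G) (n : ℕ) :
    ∃ c : ℝ, 0 < c ∧ ∀ β : ℝ, 1 ≤ β →
      c * β ^ (-(((3 * ((n + 1 : ℕ) : ℝ) ^ 4 - 1) * (dimE r.ρ : ℝ)) / 2)) ≤
        ∫ U, Real.exp (-β * wilsonAction r.ρ U) ∂(Measure.pi fun _ : Edge 4 (n + 1) => haarProbability G) := by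
  -- adapted from Theorems/TwistExponentGapPeriodicToronFloor.lean (`twistExponentGap_periodicToronFloor_proof`)
  -- countability from the faithful representation
  haveI : SecondCountableTopology (Matrix (Fin r.N) (Fin r.N) ℂ) :=
    inferInstanceAs (SecondCountableTopology (Fin r.N → Fin r.N → ℂ))
  have hemb : Topology.IsClosedEmbedding r.ρ := r.continuous.isClosedEmbedding r.injective
  haveI : SecondCountableTopology G := hemb.isEmbedding.secondCountableTopology
  obtain ⟨C, hC, hball⟩ := exists_haar_gball_ge r.ρ r.continuous r.injective r.mem_unitary
  set P : ℕ := Fintype.card (Plaquette 4 (n + 1)) with hPdef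
  set D : ℕ := dimE r.ρ with hDdef
  set R : ℕ := 3 * (n + 1) ^ 4 - 3 with hRdef
  have hR3 : 3 ≤ 3 * (n + 1) ^ 4 := by
    have : 1 ≤ (n + 1) ^ 4 := Nat.one_le_pow _ _ (Nat.succ_pos n)
    omega
  have hRreal : (R : ℝ) = 3 * ((n + 1 : ℕ) : ℝ) ^ 4 - 3 := by
    rw [hRdef, Nat.cast_sub hR3]; push_cast; ring
  refine ⟨Real.exp (-(18 * (P : ℝ))) * (C ^ 4 * C ^ R), by positivity, fun β hβ => ?_⟩
  have hβ0 : 0 < β := by linarith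
  -- the radius `t = β^{-1/4}`
  set t : ℝ := β ^ (-(1 / 4 : ℝ)) with ht
  have ht0 : 0 < t := Real.rpow_pos_of_pos hβ0 _
  have ht1 : t ≤ 1 := Real.rpow_le_one_of_one_le_of_nonpos hβ (by norm_num)
  have ht20 : 0 < t ^ 2 := pow_pos ht0 2
  have ht21 : t ^ 2 ≤ 1 := pow_le_one₀ ht0.le ht1
  have ht4 : t ^ 4 = β⁻¹ := by
    rw [ht, ← Real.rpow_natCast, ← Real.rpow_mul hβ0.le, ← Real.rpow_neg_one]
    norm_num
  -- the exponent: `t^{4D + 2DR} = β^{-(3S⁴-1)D/2}`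
  have htpow : t ^ (4 * D + 2 * D * R) = β ^ (-(((3 * ((n + 1 : ℕ) : ℝ) ^ 4 - 1) * (D : ℝ)) / 2)) := by
    rw [ht, ← Real.rpow_natCast, ← Real.rpow_mul hβ0.le]
    congr 1
    push_cast
    rw [hRreal]
    push_cast
    ring
  -- small balls
  have hB1 : C * t ^ D ≤ (haarProbability G).real {g : G | ‖r.ρ g - 1‖ ≤ t} :=
    (ENNReal.ofReal_le_iff_le_toReal (measure_ne_top _ _)).1 (hball t ht0 ht1)
  have hB2 : C * (t ^ 2) ^ D ≤ (haarProbability G).real {g : G | ‖r.ρ g - 1‖ ≤ t ^ 2} :=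
    (ENNReal.ofReal_le_iff_le_toReal (measure_ne_top _ _)).1 (hball (t ^ 2) ht20 ht21)
  -- the toron box inside the sublevel set, and Markov
  set K : ℝ := (4 * t ^ 2 + 2 * t ^ 2) ^ 2 / 2 * (P : ℝ) with hK
  have hbox := pow_mul_pow_le_measureReal_wilsonAction_le (n := n) r.ρ r.continuous r.mem_unitary ht0.le ht20.le
  have hmarkov := exp_mul_measureReal_le_integral_exp (d := 4) (L := n + 1) r.ρ r.continuous hβ0.le K
  have hβK : -β * K = -(18 * (P : ℝ)) := by
    have e1 : K = 18 * t ^ 4 * P := by rw [hK]; ring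
    rw [e1, ht4]; field_simp
  calc Real.exp (-(18 * (P : ℝ))) * (C ^ 4 * C ^ R) * β ^ (-(((3 * ((n + 1 : ℕ) : ℝ) ^ 4 - 1) * (D : ℝ)) / 2))
      = Real.exp (-(18 * (P : ℝ))) * ((C * t ^ D) ^ 4 * (C * (t ^ 2) ^ D) ^ R) := by
        rw [← htpow]; ring
    _ ≤ Real.exp (-(18 * (P : ℝ))) * ((haarProbability G).real {g : G | ‖r.ρ g - 1‖ ≤ t} ^ 4 *
          (haarProbability G).real {g : G | ‖r.ρ g - 1‖ ≤ t ^ 2} ^ R) := by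
        have h4 : (C * t ^ D) ^ 4 ≤ (haarProbability G).real {g : G | ‖r.ρ g - 1‖ ≤ t} ^ 4 :=
          pow_le_pow_left₀ (by positivity) hB1 4
        have hRR : (C * (t ^ 2) ^ D) ^ R ≤ (haarProbability G).real {g : G | ‖r.ρ g - 1‖ ≤ t ^ 2} ^ R :=
          pow_le_pow_left₀ (by positivity) hB2 R
        exact mul_le_mul_of_nonneg_left (mul_le_mul h4 hRR (by positivity) (by positivity)) (Real.exp_pos _).le
    _ ≤ Real.exp (-(18 * (P : ℝ))) * (Measure.pi fun _ : Edge 4 (n + 1) => haarProbability G).real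
          {U : GaugeConfig 4 (n + 1) G | wilsonAction r.ρ U ≤ K} :=
        mul_le_mul_of_nonneg_left hbox (Real.exp_pos _).le
    _ = Real.exp (-β * K) * (Measure.pi fun _ : Edge 4 (n + 1) => haarProbability G).real
          {U : GaugeConfig 4 (n + 1) G | wilsonAction r.ρ U ≤ K} := by rw [hβK]
    _ ≤ ∫ U, Real.exp (-β * wilsonAction r.ρ U) ∂(Measure.pi fun _ : Edge 4 (n + 1) => haarProbability G) := hmarkov

/-! ## §2 The item, by name -/

/-- ★★ **`CentreWallReflection.SubexponentialFloor`** ⟨stmt-QuantumFields-23708⟩ (BY NAME): for every compact `G`, faithful unitary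
lattice representation `r`, inline twisted partition function `Z`, `L ≥ 1`, plane `q`, `s > 0`, `ε > 0`, eventually in `β`:
`(L+1)² e^{−sβ} ≤ ε · Z(β, L+1, 1, q)`.  From the periodic toron floor `c β^{−κ} ≤ Z(β,L+1,1,q)` (`wilsonPartition_toron_floor`;
the periodic sector of `Z` is the Wilson partition integral) and `β^κ e^{−sβ} → 0`. [cite: Luscher1983, §2] [cite: BorgsSeiler1983] -/
theorem subexponentialFloor_proof :
    Summit.QuantumFields.YangMills.Theses.CentreWallReflection.SubexponentialFloor := by
  intro G _ _ _ _ _hG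
  letI : MeasurableSpace G := borel G
  haveI : BorelSpace G := ⟨rfl⟩
  intro r Z hZ L hL q s ε hs hε
  obtain ⟨c, hc, hfloor⟩ := wilsonPartition_toron_floor r L
  -- the periodic sector is the Wilson partition function
  have hZeq : ∀ β : ℝ, Z β (L + 1) 1 q =
      ∫ U, Real.exp (-β * wilsonAction r.ρ U) ∂(Measure.pi fun _ : Edge 4 (L + 1) => haarProbability G) := by
    intro β
    rw [hZ]
    refine integral_congr_ae (ae_of_all _ fun U => ?_)
    simp only [ite_self, one_mul, neg_mul, wilsonAction]
  set κ : ℝ := ((3 * ((L + 1 : ℕ) : ℝ) ^ 4 - 1) * (dimE r.ρ : ℝ)) / 2 with hκ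
  have hS : 0 < (((L + 1 : ℕ) : ℝ) ^ 2) := by positivity
  have hgoal : 0 < ε * c / (((L + 1 : ℕ) : ℝ) ^ 2) := by positivity
  have hdecay : ∀ᶠ β : ℝ in atTop, β ^ κ * Real.exp (-s * β) ≤ ε * c / (((L + 1 : ℕ) : ℝ) ^ 2) :=
    (tendsto_rpow_mul_exp_neg_mul_atTop_nhds_zero κ s hs).eventually (eventually_le_nhds hgoal)
  filter_upwards [hdecay, eventually_ge_atTop (1 : ℝ)] with β hdβ hβ1
  have hβ0 : 0 < β := by linarith
  have hZ1 : c * β ^ (-κ) ≤ Z β (L + 1) 1 q := by rw [hZeq]; exact hfloor β hβ1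
  have hβκ : 0 < β ^ κ := Real.rpow_pos_of_pos hβ0 κ
  have hsplit : Real.exp (-(s * β)) = (β ^ κ * Real.exp (-s * β)) * β ^ (-κ) := by
    rw [Real.rpow_neg hβ0.le, neg_mul]
    field_simp
  calc (((L + 1 : ℕ) : ℝ) ^ 2) * Real.exp (-(s * β))
      = (((L + 1 : ℕ) : ℝ) ^ 2) * (β ^ κ * Real.exp (-s * β)) * β ^ (-κ) := by
        rw [hsplit]; ring
    _ ≤ (((L + 1 : ℕ) : ℝ) ^ 2) * (ε * c / (((L + 1 : ℕ) : ℝ) ^ 2)) * β ^ (-κ) := by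
        gcongr
    _ = ε * (c * β ^ (-κ)) := by
        field_simp
    _ ≤ ε * Z β (L + 1) 1 q := mul_le_mul_of_nonneg_left hZ1 hε.le

end Summit.QuantumFields.YangMills.Theorems.CentreWallReflection

end
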